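import Summits.Ventures.Crystal3D.StickySpheres.FccLoomisWhitney
import Literature.MathematicalPhysics.StatisticalMechanics.StickyWulffConstants
import HarnessLib

/-!
# Labelled packings versus finite point sets: the contact-deficiency dictionary

HONEST FRAMING. Part of the venture `Summits/Ventures/Crystal3D` (cells `pub-crystal3d`,
`crystal3d-full`). Bookkeeping between the venture's LABELLED packings `x : Fin N → ℝ³`
(`IsUnitPacking`, `numContacts`, `coordination`) and the FINITE-SET vocabulary of
`Literature/MathematicalPhysics/StatisticalMechanics/StickyWulffConstants.lean` (`orderedContacts X`,
`contactDeficiency X = 6|X| − ½·orderedContacts X`, `HasSurfaceConstant L γ`,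
Cicalese–Kreutz–Leonardi 2023), plus two consequences for the cell `crystal3d-full`:

* `orderedContacts_image_eq` — for an injective `x`, `orderedContacts (range x) = 2·numContacts x`
  (ordered versus unordered pairs; the handshake `sum_coordination_eq`);
* `contactDeficiency_image_eq` — `contactDeficiency (range x) = 6N − numContacts x`;
* `hcpSurfacePenalty_of_surfaceConstants` — **`HcpSurfacePenalty`** of the cell's typed statements
  (HOME/cf-p1/lean/WulffSelection.lean; ROUTE.md §3.2, K2's known data point), CONDITIONAL on the
  named fact `CicaleseKreutzLeonardi2023_surfaceConstants`: `∃ δ > 0`, eventually every unit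
  packing of `N` balls drawn from the hcp packing `hcpStacking 1 √(2/3)` has
  `≤ 6N − (γ_fcc + δ)N^{2/3}` contacts — hcp is strictly worse than fcc at the surface
  (transport of `Literature.….hcpSurfacePenalty_of` through the dictionary);
* `six_mul_rpow_le_contactDeficiency_of_subset_fcc` — UNCONDITIONALLY, every finite subset `X`
  of the fcc packing has `contactDeficiency X ≥ 6|X|^{2/3}` (transport of the tree theorem
  `numContacts_le_of_mem_fccStacking`, `FccLoomisWhitney.lean`): the lower-bound clause of
  `HasSurfaceConstant (fccStacking 1 √(2/3)) γ` holds for every `γ ≤ 6` (the named fact asserts it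
  for every `γ < ∛432 = 7.5595…`).

WHAT THIS IS NOT: no discharge of the Cicalese–Kreutz–Leonardi fact; nothing off-lattice; rung
F-C1 of the cell is not moved by bookkeeping.
-/

noncomputable section

namespace Summit.Ventures.Crystal3D

open Finset
open Literature.MathematicalPhysics.StatisticalMechanics (barlowStacking fccStacking hcpStacking
  constHagg isHaggSeq_const orderedContacts contactDeficiency HasSurfaceConstant gammaFcc
  CicaleseKreutzLeonardi2023_surfaceConstants hcpSurfacePenalty_of
  le_dist_of_mem_barlowStacking_ideal)

/-! ## The dictionary -/

/-- **Ordered versus unordered contacts.** For an injective labelled configuration `x`, the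
number of ORDERED touching pairs of the point set `range x` is twice the contact number of `x`. -/
theorem orderedContacts_image_eq {N : ℕ} (x : Fin N → EuclideanSpace ℝ (Fin 3))
    (hx : Function.Injective x) :
    orderedContacts (univ.image x) = 2 * numContacts x := by
  classical
  rw [← sum_coordination_eq, orderedContacts]
  have hprod : (univ.image x) ×ˢ (univ.image x) =
      (univ : Finset (Fin N × Fin N)).image (fun p => (x p.1, x p.2)) := by
    ext q
    simp only [mem_product, mem_image, mem_univ, true_and, Prod.exists]
    constructor
    · rintro ⟨⟨a, ha⟩, ⟨b, hb⟩⟩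
      exact ⟨a, b, Prod.ext ha hb⟩
    · rintro ⟨a, b, rfl⟩
      exact ⟨⟨a, rfl⟩, ⟨b, rfl⟩⟩
  have hinj : Function.Injective (fun p : Fin N × Fin N => (x p.1, x p.2)) := by
    intro p q h
    simp only [Prod.mk.injEq] at h
    exact Prod.ext (hx h.1) (hx h.2)
  rw [hprod, filter_image, card_image_of_injective _ hinj]
  -- both sides count the ordered pairs `(i, j)` with `dist (x i) (x j) = 1`
  rw [card_filter, Fintype.sum_prod_type]
  refine sum_congr rfl fun i _ => ?_
  rw [coordination, contactNeighbors, card_filter]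
  refine sum_congr rfl fun j _ => ?_
  by_cases hij : j = i
  · subst hij
    simp
  · simp [hij]

/-- The point set of an injective labelled configuration of `N` points has `N` elements. -/
theorem card_image_univ_eq {N : ℕ} (x : Fin N → EuclideanSpace ℝ (Fin 3))
    (hx : Function.Injective x) : (univ.image x).card = N := by
  rw [card_image_of_injective _ hx, card_univ, Fintype.card_fin]

/-- **Contact deficiency of a labelled packing**: `contactDeficiency (range x) = 6N − C(x)`. -/
theorem contactDeficiency_image_eq {N : ℕ} (x : Fin N → EuclideanSpace ℝ (Fin 3))
    (hx : Function.Injective x) :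
    contactDeficiency (univ.image x) = 6 * (N : ℝ) - (numContacts x : ℝ) := by
  classical
  rw [contactDeficiency, card_image_univ_eq x hx, orderedContacts_image_eq x hx]
  push_cast
  ring

/-! ## hcp is strictly worse than fcc at the surface (modulo Cicalese–Kreutz–Leonardi 2023) -/

/-- **`HcpSurfacePenalty` (conditional).** Assuming the named fact
`CicaleseKreutzLeonardi2023_surfaceConstants` (surface constants `γ_fcc = ∛432 < γ_hcp = (3/2)∛130`),
there is `δ > 0` such that eventually every unit packing `x : Fin N → ℝ³` drawn from the hcp packing
`hcpStacking 1 √(2/3)` has `numContacts x ≤ 6N − (γ_fcc + δ) N^{2/3}`. -/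
theorem hcpSurfacePenalty_of_surfaceConstants (h : CicaleseKreutzLeonardi2023_surfaceConstants) :
    ∃ δ : ℝ, 0 < δ ∧ ∃ N₀ : ℕ, ∀ N : ℕ, N₀ ≤ N → ∀ x : Fin N → EuclideanSpace ℝ (Fin 3),
      IsUnitPacking x → (∀ i, x i ∈ hcpStacking 1 (Real.sqrt (2 / 3))) →
        (numContacts x : ℝ) ≤ 6 * (N : ℝ) - (gammaFcc + δ) * (N : ℝ) ^ ((2 : ℝ) / 3) := by
  classical
  obtain ⟨δ, hδ, N₀, hN₀⟩ := hcpSurfacePenalty_of h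
  refine ⟨δ, hδ, N₀, fun N hN x hx hmem => ?_⟩
  have hsub : (↑(univ.image x) : Set (EuclideanSpace ℝ (Fin 3))) ⊆
      hcpStacking 1 (Real.sqrt (2 / 3)) := by
    intro p hp
    rw [mem_coe, mem_image] at hp
    obtain ⟨i, -, rfl⟩ := hp
    exact hmem i
  have key := hN₀ N hN (univ.image x) hsub (card_image_univ_eq x hx.injective)
  rw [contactDeficiency_image_eq x hx.injective] at key
  linarith

/-! ## The fcc lower bound with constant `6`, in the finite-set vocabulary (unconditional) -/

/-- **`6|X|^{2/3} ≤ contactDeficiency X` for every finite subset `X` of the fcc packing**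
(the tree theorem `numContacts_le_of_mem_fccStacking` through the dictionary; distinct sites of
the touching fcc packing are automatically `≥ 1` apart). -/
theorem six_mul_rpow_le_contactDeficiency_of_subset_fcc (X : Finset (EuclideanSpace ℝ (Fin 3)))
    (hX : (↑X : Set (EuclideanSpace ℝ (Fin 3))) ⊆ fccStacking 1 (Real.sqrt (2 / 3))) :
    6 * (X.card : ℝ) ^ ((2 : ℝ) / 3) ≤ contactDeficiency X := by
  classical
  -- enumerate `X`
  set N := X.card with hN
  set x : Fin N → EuclideanSpace ℝ (Fin 3) := fun i => ((X.equivFin.symm i : X) : _) with hxdef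
  have hxinj : Function.Injective x := fun i j h =>
    X.equivFin.symm.injective (Subtype.ext h)
  have hmem : ∀ i, x i ∈ fccStacking 1 (Real.sqrt (2 / 3)) := fun i =>
    hX (mem_coe.2 (X.equivFin.symm i).2)
  have himage : univ.image x = X := by
    ext p
    simp only [mem_image, mem_univ, true_and]
    constructor
    · rintro ⟨i, rfl⟩
      exact (X.equivFin.symm i).2
    · intro hp
      exact ⟨X.equivFin ⟨p, hp⟩, by simp [hxdef]⟩
  have hh : (Real.sqrt (2 / 3)) ^ 2 = 2 / 3 * (1 : ℝ) ^ 2 := by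
    rw [Real.sq_sqrt (by norm_num)]; ring
  have hpack : IsUnitPacking x := fun i j hij =>
    le_dist_of_mem_barlowStacking_ideal isHaggSeq_const one_pos hh (hmem i) (hmem j)
      (fun h => hij (hxinj h))
  have hC := numContacts_le_of_mem_fccStacking x hpack hmem
  rw [← himage, contactDeficiency_image_eq x hxinj]
  linarith

/-- The lower-bound clause of `HasSurfaceConstant (fccStacking 1 √(2/3)) γ` holds for every
`γ ≤ 6`, unconditionally (the named fact `CicaleseKreutzLeonardi2023_surfaceConstants` asserts both
clauses at `γ = ∛432 = 7.5595…`). -/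
theorem fcc_surfaceLowerBound_of_le_six {γ : ℝ} (hγ : γ ≤ 6) :
    ∀ ε : ℝ, 0 < ε → ∃ N₀ : ℕ, ∀ N : ℕ, N₀ ≤ N → ∀ X : Finset (EuclideanSpace ℝ (Fin 3)),
      (↑X : Set (EuclideanSpace ℝ (Fin 3))) ⊆ fccStacking 1 (Real.sqrt (2 / 3)) →
        X.card = N → (γ - ε) * (N : ℝ) ^ ((2 : ℝ) / 3) ≤ contactDeficiency X := by
  intro ε hε
  refine ⟨0, fun N _ X hX hcard => ?_⟩
  have h := six_mul_rpow_le_contactDeficiency_of_subset_fcc X hX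
  rw [hcard] at h
  have hpow : (0 : ℝ) ≤ (N : ℝ) ^ ((2 : ℝ) / 3) := by positivity
  nlinarith

end Summit.Ventures.Crystal3D

end
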